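import Summits.QuantumFields.YangMills.Theorems.ColdStartUniversalityUniformColdStartMixingRungOfHarris
import Summits.QuantumFields.YangMills.Theorems.ColdStartUniversalityLatticeLangevinCocycleMain
import HarnessLib

/-!
# Route `ColdStartUniversality`, crux K_A2 `ColdStartContinuumCauchy` (stmt-QuantumFields-24810), LINE 3 «lindeberg_swap»:
# THE MARKOV SHIFT IDENTITY — `E φ(U_{s+t}) = E (P_t φ)(U_s)` for EVERY realisation

Helper file (seat `ym-line-csu-p1`, g9; `--supports stmt-QuantumFields-24810`).  Brick (iv′) of the proof plan for the rung
`stub_shortWindowSwap` (memo v3 on the crux): for the SU(2) lattice Langevin (SZZ) dynamics at any coupling, every solution `U` from a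
deterministic start `x` on ANY probability space, every jointly measurable solution family `V` on ANY (other) probability space, every
bounded measurable observable `φ` and lattice times `s, t`:

  `∫ φ(U_{s+t}) dP = ∫ (markovTransition V P₂ t φ)(U_s) dP`        (`integral_add_eq_integral_markovTransition`).

This is the ONE-TIME form of the Markov property at deterministic times: the law of `U_{s+t}` is `κ_{s+t}(x, ·)` for THE transition
kernels (`exists_transitionKernel`, uniqueness in law from the start), Chapman–Kolmogorov `κ_{s+t} = κ_t ∘ₖ κ_s`
(`chapmanKolmogorov_szz`), and `P_t φ = ∫ φ dκ_t` along any family (as in `TransportPerturbation.markovTransition_add`; re-derived here so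
that this module does not depend on a route file).
It turns the one-window swap error of LINE 3 — `E g(stepDown U'((t₀+τ)/ε')) − E (P_τ g)(stepDown U'(t₀/ε'))` — into the expectation
of the ONE-TIME commutator `(P'_τ (g∘stepDown) − (P_τ g)∘stepDown)(U'(t₀/ε'))` (`integral_window_eq_integral_commutator`), which is the
shape both the rung (DCT against the law of `U'(t₀)`) and the XL stub `stub_oneWindowSwap` work with.  THEOREMS ONLY, no sorry.
HONEST FRAMING: plumbing; no crux, rung or summit is proved; the Yang–Mills mass gap is NOT proved.
-/

set_option autoImplicit false

noncomputable section

namespace Summit.QuantumFields.YangMills.Theorems.ColdStartUniversality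

open MeasureTheory ProbabilityTheory
open scoped NNReal ENNReal
open Literature.Probability.Process Literature.MathematicalPhysics.QuantumFieldTheory
open Literature.MathematicalPhysics.QuantumLattice (fundamentalRep fundamentalLatticeRep)

/-- ★ **The Markov shift identity for the SZZ dynamics, for every realisation**: `∫ φ(U_{s+t}) dP = ∫ (P_t φ)(U_s) dP` for every
solution `U` from a deterministic start on any space, every jointly measurable solution family `V` (any space) defining
`P_t φ = markovTransition V P₂ t φ`, every bounded measurable `φ` and all `s, t`.
[cite: ShenZhuZhu2022, §3 (after Lemma 3.3, p. 13)] [cite: RevuzYor1999, Ch. IX Thm (1.7)] -/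
theorem integral_add_eq_integral_markovTransition {L : ℕ} [NeZero L] (β' : ℝ)
    (x : GaugeConfig 3 L (Matrix.specialUnitaryGroup (Fin 2) ℂ))
    {Ω : Type} [MeasurableSpace Ω] {P : Measure Ω} [IsProbabilityMeasure P]
    {W : ℝ≥0 → Ω → (Edge 3 L × NoiseIdx 2 → ℝ)} (hW : IsFlatBrownian W P)
    {U : ℝ≥0 → Ω → GaugeConfig 3 L (Matrix.specialUnitaryGroup (Fin 2) ℂ)} (hU0 : ∀ ω, U 0 ω = x)
    (hU : (latticeLangevinDynamics (fundamentalLatticeRep 2) β').IsSolution (fundamentalRep (Fin 2)) hW.natFiltration P W U)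
    {Ω₂ : Type} [MeasurableSpace Ω₂] {P₂ : Measure Ω₂} [IsProbabilityMeasure P₂]
    {W₂ : ℝ≥0 → Ω₂ → (Edge 3 L × NoiseIdx 2 → ℝ)} (hW₂ : IsFlatBrownian W₂ P₂)
    (V : GaugeConfig 3 L (Matrix.specialUnitaryGroup (Fin 2) ℂ) → ℝ≥0 → Ω₂ →
      GaugeConfig 3 L (Matrix.specialUnitaryGroup (Fin 2) ℂ))
    (hV : ∀ y, (∀ ω, V y 0 ω = y) ∧
      (latticeLangevinDynamics (fundamentalLatticeRep 2) β').IsSolution (fundamentalRep (Fin 2)) hW₂.natFiltration P₂ W₂ (V y))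
    (hVm : ∀ t : ℝ≥0, Measurable fun p : GaugeConfig 3 L (Matrix.specialUnitaryGroup (Fin 2) ℂ) × Ω₂ => V p.1 t p.2)
    {φ : GaugeConfig 3 L (Matrix.specialUnitaryGroup (Fin 2) ℂ) → ℝ} (hφ : Measurable φ) {M : ℝ} (hM : ∀ u, |φ u| ≤ M)
    (s t : ℝ≥0) :
    ∫ ω, φ (U (s + t) ω) ∂P = ∫ ω, markovTransition V P₂ t φ (U s ω) ∂P := by
  classical
  obtain ⟨κ, hκM, -, hreal⟩ := exists_transitionKernel L β'
  haveI := hκM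
  -- laws of `U` and of the family through THE kernels
  have hlawU : ∀ u : ℝ≥0, κ u x = P.map (U u) := fun u => hreal u x Ω P W hW U hU0 hU
  have hVx : ∀ (u : ℝ≥0) y, Measurable (V y u) := fun u y => (hVm u).comp measurable_prodMk_left
  have hlawV : ∀ (u : ℝ≥0) y, κ u y = P₂.map (V y u) := fun u y => hreal u y Ω₂ P₂ W₂ hW₂ (V y) (hV y).1 (hV y).2
  have hrep : markovTransition V P₂ t φ = fun y => ∫ z, φ z ∂(κ t y) := by
    funext y
    rw [hlawV t y, integral_map (hVx t y).aemeasurable hφ.aestronglyMeasurable]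
    rfl
  have hQm : Measurable fun y => ∫ z, φ z ∂(κ t y) := (hφ.stronglyMeasurable.integral_kernel (κ := κ t)).measurable
  have hmU : ∀ u : ℝ≥0, Measurable (U u) := fun u => (hU.adapted u).mono (hW.natFiltration.le u) le_rfl
  -- left side through the kernel at time `s + t`, Chapman–Kolmogorov, and back through the kernel at time `s`
  have hint : Integrable φ ((κ s x).bind (κ t)) := by
    haveI : IsProbabilityMeasure ((κ s x).bind (κ t)) := by
      constructor
      rw [Measure.bind_apply MeasurableSet.univ (κ t).measurable.aemeasurable]
      simp
    exact (integrable_const M).mono' hφ.aestronglyMeasurable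
      (Filter.Eventually.of_forall fun z => by simpa [Real.norm_eq_abs] using hM z)
  calc ∫ ω, φ (U (s + t) ω) ∂P = ∫ z, φ z ∂(P.map (U (s + t))) :=
        (integral_map (hmU _).aemeasurable hφ.aestronglyMeasurable).symm
    _ = ∫ z, φ z ∂((κ t ∘ₖ κ s) x) := by rw [← hlawU, chapmanKolmogorov_szz β' κ hreal s t]
    _ = ∫ y, ∫ z, φ z ∂(κ t y) ∂(κ s x) := by
        rw [Kernel.comp_apply]
        exact Literature.Probability.Process.Harris.integral_comp_measure (κ t) (κ s x) hint
    _ = ∫ y, markovTransition V P₂ t φ y ∂(P.map (U s)) := by rw [hrep, hlawU]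
    _ = ∫ ω, markovTransition V P₂ t φ (U s ω) ∂P := by
        rw [hrep]
        exact integral_map (hmU _).aemeasurable hQm.aestronglyMeasurable

/-- **The one-window swap error is the expectation of a one-time commutator.**  For a solution `U'` from a deterministic start on any
space (fine dynamics, coupling `β₁`), a jointly measurable fine family `V'` and ANY operator `Q` on coarse observables (e.g. the coarse
transition operator `P_τ`), any measurable `S` (e.g. `stepDown`) and bounded measurable `g` with `Q g` measurable:
`∫ g(S(U'_{s+t})) dP − ∫ (Q g)(S(U'_s)) dP = ∫ [P'_t (g∘S) − (Q g)∘S](U'_s) dP`, provided `(Q g)∘S∘U'_s` is integrable. [folklore] -/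
theorem integral_window_eq_integral_commutator {L L' : ℕ} [NeZero L] [NeZero L'] (β₁ : ℝ)
    (x : GaugeConfig 3 L' (Matrix.specialUnitaryGroup (Fin 2) ℂ))
    {Ω : Type} [MeasurableSpace Ω] {P : Measure Ω} [IsProbabilityMeasure P]
    {W : ℝ≥0 → Ω → (Edge 3 L' × NoiseIdx 2 → ℝ)} (hW : IsFlatBrownian W P)
    {U' : ℝ≥0 → Ω → GaugeConfig 3 L' (Matrix.specialUnitaryGroup (Fin 2) ℂ)} (hU0 : ∀ ω, U' 0 ω = x)
    (hU : (latticeLangevinDynamics (fundamentalLatticeRep 2) β₁).IsSolution (fundamentalRep (Fin 2)) hW.natFiltration P W U')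
    {Ω₃ : Type} [MeasurableSpace Ω₃] {P₃ : Measure Ω₃} [IsProbabilityMeasure P₃]
    {W₃ : ℝ≥0 → Ω₃ → (Edge 3 L' × NoiseIdx 2 → ℝ)} (hW₃ : IsFlatBrownian W₃ P₃)
    (V' : GaugeConfig 3 L' (Matrix.specialUnitaryGroup (Fin 2) ℂ) → ℝ≥0 → Ω₃ →
      GaugeConfig 3 L' (Matrix.specialUnitaryGroup (Fin 2) ℂ))
    (hV' : ∀ y, (∀ ω, V' y 0 ω = y) ∧
      (latticeLangevinDynamics (fundamentalLatticeRep 2) β₁).IsSolution (fundamentalRep (Fin 2)) hW₃.natFiltration P₃ W₃ (V' y))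
    (hV'm : ∀ t : ℝ≥0, Measurable fun p : GaugeConfig 3 L' (Matrix.specialUnitaryGroup (Fin 2) ℂ) × Ω₃ => V' p.1 t p.2)
    {S : GaugeConfig 3 L' (Matrix.specialUnitaryGroup (Fin 2) ℂ) → GaugeConfig 3 L (Matrix.specialUnitaryGroup (Fin 2) ℂ)}
    (hS : Measurable S)
    {g : GaugeConfig 3 L (Matrix.specialUnitaryGroup (Fin 2) ℂ) → ℝ} (hg : Measurable g) {M : ℝ} (hM : ∀ u, |g u| ≤ M)
    (Qg : GaugeConfig 3 L (Matrix.specialUnitaryGroup (Fin 2) ℂ) → ℝ)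
    (s t : ℝ≥0) (hint : Integrable (fun ω => Qg (S (U' s ω))) P) :
    (∫ ω, g (S (U' (s + t) ω)) ∂P) - ∫ ω, Qg (S (U' s ω)) ∂P =
      ∫ ω, (markovTransition V' P₃ t (fun u => g (S u)) (U' s ω) - Qg (S (U' s ω))) ∂P := by
  have hφ : Measurable fun u => g (S u) := hg.comp hS
  have hφM : ∀ u, |(fun u => g (S u)) u| ≤ M := fun u => hM _
  have h1 := integral_add_eq_integral_markovTransition β₁ x hW hU0 hU hW₃ V' hV' hV'm hφ hφM s t
  have hmU : Measurable (U' s) := (hU.adapted s).mono (hW.natFiltration.le s) le_rfl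
  -- `P'_t (g∘S)` is measurable and bounded by `M` (through THE kernels)
  obtain ⟨κ, hκM, -, hreal⟩ := exists_transitionKernel L' β₁
  haveI := hκM
  have hVx : ∀ y, Measurable (V' y t) := fun y => (hV'm t).comp measurable_prodMk_left
  have hrep : markovTransition V' P₃ t (fun u => g (S u)) = fun y => ∫ z, g (S z) ∂(κ t y) := by
    funext y
    rw [hreal t y Ω₃ P₃ W₃ hW₃ (V' y) (hV' y).1 (hV' y).2, integral_map (hVx y).aemeasurable hφ.aestronglyMeasurable]
    rfl
  have hQm : Measurable (markovTransition V' P₃ t (fun u => g (S u))) := by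
    rw [hrep]; exact (hφ.stronglyMeasurable.integral_kernel (κ := κ t)).measurable
  have hQb : ∀ y, |markovTransition V' P₃ t (fun u => g (S u)) y| ≤ M := by
    intro y
    rw [hrep]
    have h := norm_integral_le_of_norm_le_const (μ := κ t y) (f := fun z => g (S z)) (C := M)
      (Filter.Eventually.of_forall fun z => by simpa [Real.norm_eq_abs] using hM (S z))
    simpa [Real.norm_eq_abs] using h
  have hint1 : Integrable (fun ω => markovTransition V' P₃ t (fun u => g (S u)) (U' s ω)) P :=
    (integrable_const M).mono' (hQm.comp hmU).aestronglyMeasurable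
      (Filter.Eventually.of_forall fun ω => by simpa [Real.norm_eq_abs] using hQb (U' s ω))
  change (∫ ω, (fun u => g (S u)) (U' (s + t) ω) ∂P) - _ = _
  rw [h1, ← integral_sub hint1 hint]

end Summit.QuantumFields.YangMills.Theorems.ColdStartUniversality

end
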